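import Literature.AlgebraicGeometry.HodgeTheory.QuaternionicQuarticFamilyOfCover
import Literature.AlgebraicGeometry.HodgeTheory.QuaternionicQuarticCoverFibres
import HarnessLib

/-!
# «Q-FAMILY» holds: `Q8Family.QFamily e` for `e ≥ 2` (final assembly QF-5c)

Layer `Literature/AlgebraicGeometry/HodgeTheory`. One theorem, no definition, no named fact. Assembly written by
prover-Bx g18 (skeleton, 2026-08-29T08:35Z) and compiled/landed by the prover seat `hodge-nonav-19716-p2` (g13, cell
`hodge-nonav`) once its bricks QF-1b C1–C3 (`QuaternionicQuarticCover`, `…PrimeSpecialisation`, `…CoverGeneric`,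
`…CoverFibres`) were in the tree: `qFamily_of_cover` (QF-5b, prover-Bx) applied to the universal quaternionic
quartic `cover e`, with `K = FractionRing A`, the generic-fibre facts (C2) read through `coverGen_eq_tensor` (`rfl`),
the good open `D(G_e)` of `genericityElem`, and the complex fibres (C3) over `MvPolynomial.eval a`. Programme
Q-FAMILY of route `HodgeConjecture/Q8SymplecticPowers` (crux K1Q, stmt-HodgeConjecture-24190): the CDK-free family
INPUT for the «very general on every good pencil» reading; nothing here bears on HC / HC_AV, and K1Q itself is
untouched.
-/

noncomputable section

open CategoryTheory CategoryTheory.Limits AlgebraicGeometry MvPolynomial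
  MonoidalCategory CartesianMonoidalCategory
open Literature.AlgebraicGeometry.Motives

namespace Literature.AlgebraicGeometry.HodgeTheory.Q8Family

/-- **«Q-FAMILY»** (`QFamily e`) for every `e ≥ 2`: the quaternionic quartic multiple planes
`x₃⁴x₂^{2e} = c(σc)³((x₀−x₁)ψ)²` come in ONE smooth projective family of surfaces over a non-empty open of
the parameter space `𝔸^{CIdx e}`, with quasi-projective total space and smooth quasi-projective base,
fibrewise birational over `ℂ` to the reduced quartic surfaces (`qFamily_of_cover` applied to the universal
quaternionic quartic `cover e` of `QuaternionicQuarticCover*`). [cite: EGAIV3, §8.10.5] [cite: Kollar2007, Thm. 3.36] -/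
theorem qFamily_holds (e : ℕ) (he : 2 ≤ e) : QFamily e := by
  have he1 : 1 ≤ e := le_trans (by norm_num) he
  -- K := the fraction field of the parameter ring
  let K : Type := FractionRing (MvPolynomial (CIdx e) ℂ)
  -- C2, in the `⊗ / snd` currency of `qFamily_of_cover` (`coverGen_eq_tensor` is `rfl`)
  haveI : IsIntegral (cover e ⊗ specOver (MvPolynomial (CIdx e) ℂ) K).left :=
    isIntegral_coverGen_left e K he            -- C2: IsIntegral (coverGen e K).left
  haveI : GeometricallyIrreducible (snd (cover e) (specOver (MvPolynomial (CIdx e) ℂ) K)).left :=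
    geometricallyIrreducible_coverGen_hom e K he
  have hproj : IsProjectiveOver
      (Over.mk (snd (cover e) (specOver (MvPolynomial (CIdx e) ℂ) K)).left : SchemeOver K) :=
    isProjectiveOver_coverGen e K              -- via coverGen_eq_tensor (rfl)
  have hdim : topologicalKrullDim ↥(cover e ⊗ specOver (MvPolynomial (CIdx e) ℂ) K).left = 2 :=
    topologicalKrullDim_coverGen e K he
  refine qFamily_of_cover e (K := K) (cover e) hproj hdim (genericityElem e)
    (genericityElem_ne_zero e he) fun a ha => ⟨?_, fun V hV => ?_⟩
  · -- C3 (irreducibility of the complex fibre off `V(G_e)`)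
    exact irreducibleSpace_fiber_of_genericity e (MvPolynomial.eval a) he1 ha
  · -- C3 (the complex fibre is the hypersurface): `fun i ↦ eval a (X i) = a`
    have hV' : IsHypersurfaceCutOutBy 3
        (quarticForm e (cOf fun i ↦ MvPolynomial.eval a (X i)) (ψOf fun i ↦ MvPolynomial.eval a (X i))) V := by
      simpa only [MvPolynomial.eval_X] using hV
    exact ⟨(nonempty_iso_of_isHypersurfaceCutOutBy_quarticForm e (MvPolynomial.eval a) he1 ha hV').some.symm⟩

end Literature.AlgebraicGeometry.HodgeTheory.Q8Family

end
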